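import Summits.Ventures.LatticeQCDFlow.TrivializingMaps.FisherZerosExist
import Summits.Ventures.LatticeQCDFlow.TrivializingMaps.WilsonMeasureTrivializingMap
import Literature.RepresentationTheory.CompactGroups.UnitaryTrick
import Summits.Ventures.LatticeQCDFlow.Runbook.LatticeQCDFlowSanity

/-!
HONEST FRAMING: exact (Metropolis-corrected) sampling algorithms for lattice gauge theory; figures
of merit are autocorrelation/cost numbers at stated couplings and volumes; no continuum-physics
claim.

# WilsonActionFluctuates — the `SU(n)` Wilson action is not `D[U]`-a.e. constant, so every finite
# volume `L ≥ 2` of the Wilson theory (`d ≥ 2`, `n ≥ 2`) HAS FISHER ZEROS (lean-2 GEN-6, ours)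

Venture-side (OURS, never `Literature/`). Cell `lqcd-flow` (pub-lqcd), unit `pub-lqcd-lean-2-g6`,
2026-08-22.  Companion of `FisherZerosExist` (a bounded observable with positive variance under the
trivial theory has a complex-MGF zero): this file discharges the variance hypothesis for the action
the venture is about.

* `exists_specialUnitary_re_trace_eq` — for `n ≥ 2` there is `g ∈ SU(n)` with `Re tr g = n - 2`
  (`g = diag(i, -i, 1, …, 1)`).
* `exists_wilsonAction_ge_two` — for `d ≥ 2`, `n ≥ 2`, `L ≥ 2` the configuration equal to `g` on one
  link and to `1` elsewhere has Wilson action `≥ 2` (the plaquette through that link in the `(0,1)`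
  plane has holonomy `g`; all terms are `≥ 0`), while the identity configuration has action `0` (`Runbook.wilsonAction_one`).
* **`wilson_variance_pos`** — hence `Var_{D[U]}(S_W ∘ ι) > 0`: a continuous function on `SU(n)^E`
  taking two values is not a.e. constant under the product Haar measure (full support).
* **`wilson_exists_fisherZero`** — so `Z_L(s) = ∫ D[U] e^{-s S_W}` has a zero `s₀` (necessarily
  `Im s₀ ≠ 0`), and `wilson_infDist_zeroSet_pos` — every real coupling is at positive distance from
  the (non-empty, closed) Fisher zero set: the hypotheses "`Z_L(s₀) = 0`" of COROLLARY F′, THEOREM F″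
  and of the Wilson staircase theorems (rows 70, 71, 92b, 92d, 92e) are INHABITED for every `L ≥ 2`.

NOT CLAIMED: the case `L = 1` (true — `SU(n)` is non-abelian — but the one-link witness needs
`L ≥ 2`); the number or location of the zeros; `U(1)` or other groups; anything about cost,
autocorrelation or the continuum.
-/

open MeasureTheory ProbabilityTheory Filter Topology Complex Set Metric
open Literature.MathematicalPhysics.QuantumFieldTheory
open Literature.MathematicalPhysics.QuantumFieldTheory.Luscher2010
open Literature.MathematicalPhysics.QuantumFieldTheory.WilsonFlow (coeConfig continuous_coeConfig)
open scoped Matrix Matrix.Norms.Frobenius ContDiff ComplexConjugate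

namespace Summit.Ventures.LatticeQCDFlow.TrivializingMaps

/-! ## §1 A special unitary matrix with `Re tr g = n - 2` -/

section Matrices

/-- `diag(i, -i, 1, …, 1) ∈ SU(m+2)` has trace `m`. [folklore] -/
theorem exists_specialUnitary_trace_eq (m : ℕ) :
    ∃ g : Matrix.specialUnitaryGroup (Fin (m + 2)) ℂ,
      ((g : Matrix (Fin (m + 2)) (Fin (m + 2)) ℂ)).trace = (m : ℂ) := by
  set v : Fin (m + 2) → ℂ := fun i => if i = 0 then I else if i = 1 then -I else 1 with hvdef
  have hv0 : v 0 = I := by simp [hvdef]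
  have hv1 : v 1 = -I := by simp [hvdef]
  have hvss : ∀ i : Fin m, v i.succ.succ = 1 := fun i => by
    simp [hvdef, Fin.succ_ne_zero, Fin.succ_succ_ne_one]
  have hstar : ∀ i, v i * star (v i) = 1 := by
    intro i
    by_cases h0 : i = 0
    · subst h0; rw [hv0]; simp [Complex.conj_I]
    by_cases h1 : i = 1
    · subst h1; rw [hv1]; simp [Complex.conj_I]
    have : v i = 1 := by simp [hvdef, h0, h1]
    rw [this]; simp
  have hunit : Matrix.diagonal v ∈ Matrix.unitaryGroup (Fin (m + 2)) ℂ := by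
    rw [Matrix.mem_unitaryGroup_iff, Matrix.star_eq_conjTranspose, Matrix.diagonal_conjTranspose,
      Matrix.diagonal_mul_diagonal]
    have : (fun i => v i * star v i) = fun _ => (1 : ℂ) := funext fun i => hstar i
    rw [this, Matrix.diagonal_one]
  have hdet : (Matrix.diagonal v).det = 1 := by
    rw [Matrix.det_diagonal, Fin.prod_univ_succ, Fin.prod_univ_succ]
    simp only [Fin.succ_zero_eq_one, hv0, hv1, hvss, Finset.prod_const_one, mul_one]
    rw [mul_neg, Complex.I_mul_I, neg_neg]
  refine ⟨⟨Matrix.diagonal v, Matrix.mem_specialUnitaryGroup_iff.mpr ⟨hunit, hdet⟩⟩, ?_⟩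
  show (Matrix.diagonal v).trace = (m : ℂ)
  rw [Matrix.trace_diagonal, Fin.sum_univ_succ, Fin.sum_univ_succ]
  simp only [Fin.succ_zero_eq_one, hv0, hv1, hvss, Finset.sum_const, Finset.card_univ,
    Fintype.card_fin, nsmul_eq_mul, mul_one]
  ring

/-- For `n ≥ 2` there is `g ∈ SU(n)` with `Re tr g = n - 2`. [folklore] -/
theorem exists_specialUnitary_re_trace_eq {n : ℕ} (hn : 2 ≤ n) :
    ∃ g : Matrix.specialUnitaryGroup (Fin n) ℂ,
      ((g : Matrix (Fin n) (Fin n) ℂ)).trace.re = (n : ℝ) - 2 := by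
  obtain ⟨m, rfl⟩ : ∃ m, n = m + 2 := ⟨n - 2, by omega⟩
  obtain ⟨g, hg⟩ := exists_specialUnitary_trace_eq m
  refine ⟨g, ?_⟩
  rw [hg]
  push_cast
  simp

end Matrices

/-! ## §2 A one-link configuration with Wilson action `≥ 2` -/

section OneLink

variable {d L n : ℕ} [NeZero L]

omit [NeZero L] in
/-- Each plaquette term `n - Re tr U_p` of the `SU(n)` Wilson action is non-negative. [folklore] -/
theorem wilson_plaquette_term_nonneg
    (U : GaugeConfig d L (Matrix.specialUnitaryGroup (Fin n) ℂ)) (x : Site d L) (i j : Fin d) :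
    0 ≤ (n : ℝ) - ((StrongCoupling.defRep n) (plaquetteHolonomy U x i j)).trace.re := by
  have h := Literature.RepresentationTheory.CompactGroups.CompactGroup.abs_re_trace_le_card
    (StrongCoupling.defRep n) continuous_subtype_val (plaquetteHolonomy U x i j)
  rw [Fintype.card_fin] at h
  linarith [le_abs_self ((StrongCoupling.defRep n) (plaquetteHolonomy U x i j)).trace.re]

/-- **A witness of fluctuation.** For `d ≥ 2`, `n ≥ 2`, `L ≥ 2` there is a configuration of
`SU(n)^E` with Wilson action `≥ 2` (one link set to `diag(i,-i,1,…,1)`), while the identity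
configuration has action `0`. [ours] -/
theorem exists_wilsonAction_ge_two (hd : 2 ≤ d) (hn : 2 ≤ n) (hL : 2 ≤ L) :
    ∃ U : GaugeConfig d L (Matrix.specialUnitaryGroup (Fin n) ℂ),
      2 ≤ wilsonAction (StrongCoupling.defRep n) U := by
  classical
  haveI : Fact (1 < L) := ⟨by omega⟩
  obtain ⟨g, hg⟩ := exists_specialUnitary_re_trace_eq hn
  set i0 : Fin d := ⟨0, by omega⟩ with hi0
  set i1 : Fin d := ⟨1, by omega⟩ with hi1
  have h01 : i0 ≠ i1 := by simp [hi0, hi1, Fin.ext_iff]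
  have hlt : i0 < i1 := by simp [hi0, hi1, Fin.lt_def]
  set e₀ : Edge d L := ((0 : Site d L), i0) with he₀
  set U : GaugeConfig d L (Matrix.specialUnitaryGroup (Fin n) ℂ) :=
    Function.update (fun _ => 1) e₀ g with hUdef
  have hshift : (0 : Site d L).shift i1 ≠ 0 := by
    intro h
    have h1 : ((0 : Site d L).shift i1) i1 = (0 : Site d L) i1 := by rw [h]
    simp [Site.shift] at h1
  have hU0 : U e₀ = g := by simp [hUdef]
  have hU1 : U ((0 : Site d L).shift i0, i1) = 1 := by
    rw [hUdef, Function.update_of_ne (fun h => h01.symm (congrArg Prod.snd h))]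
  have hU2 : U ((0 : Site d L).shift i1, i0) = 1 := by
    rw [hUdef, Function.update_of_ne (fun h => hshift (congrArg Prod.fst h))]
  have hU3 : U ((0 : Site d L), i1) = 1 := by
    rw [hUdef, Function.update_of_ne (fun h => h01.symm (congrArg Prod.snd h))]
  have hhol : plaquetteHolonomy U 0 i0 i1 = g := by
    rw [plaquetteHolonomy, hU1, hU2, hU3, ← he₀, hU0]
    simp
  refine ⟨U, ?_⟩
  set p₀ : Plaquette d L := ((0 : Site d L), ⟨(i0, i1), hlt⟩) with hp₀
  have hterm : (n : ℝ) - ((StrongCoupling.defRep n)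
      (plaquetteHolonomy U p₀.1 p₀.2.1.1 p₀.2.1.2)).trace.re = 2 := by
    have : plaquetteHolonomy U p₀.1 p₀.2.1.1 p₀.2.1.2 = g := hhol
    rw [this]
    simp only [StrongCoupling.defRep, Submonoid.subtype_apply]
    rw [hg]
    ring
  calc (2 : ℝ) = (n : ℝ) - ((StrongCoupling.defRep n)
        (plaquetteHolonomy U p₀.1 p₀.2.1.1 p₀.2.1.2)).trace.re := hterm.symm
    _ ≤ wilsonAction (StrongCoupling.defRep n) U :=
        Finset.single_le_sum (f := fun p : Plaquette d L => (n : ℝ) -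
          ((StrongCoupling.defRep n) (plaquetteHolonomy U p.1 p.2.1.1 p.2.1.2)).trace.re)
          (fun p _ => wilson_plaquette_term_nonneg U p.1 p.2.1.1 p.2.1.2) (Finset.mem_univ p₀)

end OneLink

/-! ## §3 Positive variance, hence Fisher zeros, for the Wilson theory -/

section Wilson

variable {d L n : ℕ} [NeZero L]

/-- The trivial theory `D[U]` on `SU(n)^E` charges every non-empty open set (product of Haar
probability measures). [folklore] -/
theorem isOpenPosMeasure_trivialMeasure_SU :
    (trivialMeasure (Matrix.specialUnitaryGroup (Fin n) ℂ) d L).IsOpenPosMeasure := by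
  unfold trivialMeasure haarProbability
  infer_instance

/-- **The `SU(n)` Wilson action fluctuates in the trivial theory**: `Var_{D[U]}(S_W ∘ ι) > 0` for
`d ≥ 2`, `n ≥ 2`, `L ≥ 2`. [ours] -/
theorem wilson_variance_pos (hd : 2 ≤ d) (hn : 2 ≤ n) (hL : 2 ≤ L) :
    0 < variance (fun U => ambWilsonAction (coeConfig U))
      (trivialMeasure (Matrix.specialUnitaryGroup (Fin n) ℂ) d L) := by
  set D := trivialMeasure (Matrix.specialUnitaryGroup (Fin n) ℂ) d L with hDdef
  set X : GaugeConfig d L (Matrix.specialUnitaryGroup (Fin n) ℂ) → ℝ :=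
    fun U => ambWilsonAction (coeConfig U) with hXdef
  haveI : D.IsOpenPosMeasure := isOpenPosMeasure_trivialMeasure_SU
  have hXc : Continuous X := continuous_comp_coeConfig contDiff_ambWilsonAction
  have hXi : Integrable X D := integrable_trivialMeasure_of_continuous hXc
  obtain ⟨b, hb⟩ :=
    exists_abs_le_of_contDiff (d := d) (L := L) (n := n) contDiff_ambWilsonAction
  have hmem : MemLp X 2 D :=
    MemLp.of_bound hXi.aestronglyMeasurable b
      (ae_of_all _ fun U => by simpa [Real.norm_eq_abs] using hb U)
  refine lt_of_le_of_ne (variance_nonneg X D) fun hvar => ?_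
  -- `Var X = 0` ⇒ `X` is a.e. constant ⇒ (continuity, full support) constant
  have hev : evariance X D = 0 := by rw [← ofReal_variance hmem, ← hvar, ENNReal.ofReal_zero]
  have hae : X =ᵐ[D] fun _ => ∫ U, X U ∂D := (evariance_eq_zero_iff hXi.aemeasurable).mp hev
  have hconst : X = fun _ => ∫ U, X U ∂D := (hXc.ae_eq_iff_eq D continuous_const).mp hae
  -- but `X 1 = 0` and `X U₂ ≥ 2`
  obtain ⟨U₂, hU₂⟩ := exists_wilsonAction_ge_two (L := L) hd hn hL
  have h1 : X (fun _ => 1) = 0 := by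
    simp only [hXdef, StrongCoupling.ambWilsonAction_coeConfig]
    exact Runbook.wilsonAction_one (StrongCoupling.defRep n)
  have h2 : 2 ≤ X U₂ := by
    simp only [hXdef, StrongCoupling.ambWilsonAction_coeConfig]
    exact hU₂
  have h3 : X (fun _ => 1) = X U₂ := by rw [hconst]
  linarith

/-- **The finite-volume `SU(n)` Wilson partition function has a Fisher zero** (`d ≥ 2`, `n ≥ 2`,
every `L ≥ 2`): `Z_L(s₀) = ∫ D[U] e^{-s₀ S_W} = 0` for some `s₀ ∈ ℂ` (with `Im s₀ ≠ 0`).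
[ours] -/
theorem wilson_exists_fisherZero (hd : 2 ≤ d) (hn : 2 ≤ n) (hL : 2 ≤ L) :
    ∃ s₀ : ℂ, complexMGF (fun U => -ambWilsonAction (coeConfig U))
      (trivialMeasure (Matrix.specialUnitaryGroup (Fin n) ℂ) d L) s₀ = 0 :=
  exists_actionZ_eq_zero_of_variance_pos contDiff_ambWilsonAction (wilson_variance_pos hd hn hL)

/-- The Fisher zero set of the volume-`L` Wilson theory is non-empty and every real coupling is at
positive distance from it (`d ≥ 2`, `n ≥ 2`, `L ≥ 2`). [ours] -/
theorem wilson_infDist_zeroSet_pos (hd : 2 ≤ d) (hn : 2 ≤ n) (hL : 2 ≤ L) (x : ℝ) :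
    0 < infDist (x : ℂ) {s : ℂ | complexMGF (fun U => -ambWilsonAction (coeConfig U))
      (trivialMeasure (Matrix.specialUnitaryGroup (Fin n) ℂ) d L) s = 0} :=
  infDist_actionZ_zeroSet_pos contDiff_ambWilsonAction (wilson_variance_pos hd hn hL) x

end Wilson

end Summit.Ventures.LatticeQCDFlow.TrivializingMaps
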